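import Literature.AlgebraicGeometry.Motives.ChowFamilyCoherent
import Literature.AlgebraicGeometry.Motives.CechCoherentDevissage
import Mathlib.Data.Sum.Order
import HarnessLib

/-!
# The Čech cohomology of the Chow family is finitely generated (Leray for the Chow cover, in
# Čech form; Görtz–Wedhorn II, proof of Thm. 23.17)

Continuing `Motives/ChowFamilyCoherent` (`π : Z → V` a Chow cover, `ι : Z ↪ 𝐏ⁿ_A`, the coherent Chow
family `𝓖_d t = Γ(U_t, π_*𝒪_Z(dH)) ⊆ K(V)` on a cover `𝔘` of `V`): if `d` is large enough that
Serre's vanishing theorem holds for `𝒪_Z(dH)` on every `π⁻¹U_s` (`R^iπ_*𝒪_Z(dH) = 0`, `i ≥ 1`, in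
the Čech form `LaurentCech.exists_forall_exactAt_evCplx` over the rings `Γ(U_s, 𝒪_V)`), then ALL
the cohomology modules of the ordered Čech complex `Č•(𝔘, 𝓖_d)` are finitely generated over the
Noetherian ring `A` (`ChowFamily.moduleFinite_homology_fam`). Proof (Leray's comparison without
spectral sequences): on `Z` consider the pointwise family `Pd d` (stalks of `𝒪_Z(dH)`) and the
UNION of the two finite covers `(π⁻¹U_a)_a` and `(Z_{ℓ_j})_j`; deleting the affine members `Z_{ℓ_j}`
does not change the Čech cohomology (`PtFamily.quasiIso_restrictJ_of_affine`: the `Z_{ℓ_j}` and all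
their intersections with the other members are affine, `SeparatedAffinePreimage.isAffineOpen_inf_preimage`,
and `𝒪_Z(dH)` is principal on them), nor does deleting the members `π⁻¹U_a`
(`PtFamily.quasiIso_restrictJ_of_base`: on `π⁻¹U_s` the family is Čech-acyclic for the `Z_{ℓ_j}` by
Serre's vanishing over `Γ(U_s, 𝒪_V)`, `ProjTwist.secs_Pd_preimage_inf_eq` and
`OrderedCech.exactAt_iff_of_coe_eq`); the first sub-cover computes `Č•(𝔘, 𝓖_d)` (through
`π^* : K(V) ⥲ K(Z)`), the second one Serre's finitely generated cohomology of `𝒪_Z(dH)`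
(`ProjTwist.secs_Pd_eq_evFam`, `LaurentCech.moduleFinite_homology_evCplx`).

Everything is proved; no named facts.

## References

* U. Görtz, T. Wedhorn, *Algebraic Geometry II* (2023): Thm. 22.9, Cor. 21.82, Thm. 23.1,
  Thm. 23.17 with proof (pp. 266, 332, 412, 424–425). [GortzWedhorn2023]
-/

noncomputable section

open CategoryTheory AlgebraicGeometry TopologicalSpace Opposite HomogeneousLocalization
open Literature.Algebra.Homology Literature.Algebra.Homology.LaurentCech
open Literature.Algebra.Homology.OrderedCech
open Literature.AlgebraicGeometry.Morphisms Literature.AlgebraicGeometry.Morphisms.ProjCech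
open Literature.AlgebraicGeometry.Motives.RatFn Literature.AlgebraicGeometry.Motives.ProjFrac
open Literature.AlgebraicGeometry.Motives.FracFamily Literature.AlgebraicGeometry.Motives.ProjTwist

universe u

attribute [local instance] MvPolynomial.gradedAlgebra
  Literature.AlgebraicGeometry.Motives.ProjBaseChange.algebraBase

namespace Literature.AlgebraicGeometry.Motives

namespace ChowFamily

/-! ### The union cover `(π⁻¹U_a)_a ∪ (Z_{ℓ_j})_j` of `Z`: index bookkeeping -/

section Union

variable {A : Type u} [CommRing A] {n : ℕ} {Z : Scheme.{u}} (ι : Z ⟶ PP A n) (c : Fin (n + 1) → A)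
  (a₀ : Fin (n + 1)) {V : Scheme.{u}} [IsIntegral V] (π : Z ⟶ V) {κ : Type} [LinearOrder κ]
  (𝔘 : CoverData V κ)

/-- The index type of the union cover: `κ` then `Fin (n+1)`, lexicographically. [folklore] -/
abbrev U2 (κ : Type) (n : ℕ) : Type := κ ⊕ₗ Fin (n + 1)

/-- The members of the union cover. [folklore] -/
def W (x : U2 κ n) : Z.Opens :=
  Sum.elim (fun a => π ⁻¹ᵁ 𝔘.U {a}) (fun j => ZH ι (ell c a₀ j)) (ofLex x)

omit [LinearOrder κ] in
/-- Members of the first kind. [folklore] -/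
@[simp] theorem W_inl (a : κ) : W ι c a₀ π 𝔘 (toLex (Sum.inl a)) = π ⁻¹ᵁ 𝔘.U {a} := rfl

omit [LinearOrder κ] in
/-- Members of the second kind. [folklore] -/
@[simp] theorem W_inr (j : Fin (n + 1)) : W ι c a₀ π 𝔘 (toLex (Sum.inr j)) = ZH ι (ell c a₀ j) := rfl

/-- The embedding of the first index set. [folklore] -/
def einl : κ ↪ U2 κ n :=
  ⟨fun a => toLex (Sum.inl a), fun _ _ h => Sum.inl_injective (toLex.injective h)⟩

/-- The embedding of the second index set. [folklore] -/
def einr : Fin (n + 1) ↪ U2 κ n :=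
  ⟨fun j => toLex (Sum.inr j), fun _ _ h => Sum.inr_injective (toLex.injective h)⟩

/-- The first sub-cover. [folklore] -/
abbrev Iset (κ : Type) [Fintype κ] (n : ℕ) : Finset (U2 κ n) := Finset.univ.map (einl (κ := κ) (n := n))

/-- The second sub-cover. [folklore] -/
abbrev Jset (κ : Type) [Fintype κ] (n : ℕ) : Finset (U2 κ n) := Finset.univ.map (einr (κ := κ) (n := n))

omit [LinearOrder κ] in
/-- Membership in `Iset`. [folklore] -/
theorem mem_Iset_iff [Fintype κ] {x : U2 κ n} : x ∈ Iset κ n ↔ ∃ a, toLex (Sum.inl a) = x := by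
  simp [Iset, einl]

omit [LinearOrder κ] in
/-- Membership in `Jset`. [folklore] -/
theorem mem_Jset_iff [Fintype κ] {x : U2 κ n} : x ∈ Jset κ n ↔ ∃ j, toLex (Sum.inr j) = x := by
  simp [Jset, einr]

/-- `κ ≅ Iset` as a surjective order embedding. [folklore] -/
def eI [Fintype κ] : κ ↪o ↥(Iset κ n) :=
  OrderEmbedding.ofMapLEIff (fun a => ⟨toLex (Sum.inl a), mem_Iset_iff.2 ⟨a, rfl⟩⟩) fun a b => by
    change (toLex (Sum.inl a) : U2 κ n) ≤ toLex (Sum.inl b) ↔ a ≤ b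
    exact Sum.Lex.inl_le_inl_iff

/-- `eI` is onto. [folklore] -/
theorem eI_surjective [Fintype κ] : Function.Surjective (eI (κ := κ) (n := n)) := by
  rintro ⟨x, hx⟩
  obtain ⟨a, rfl⟩ := mem_Iset_iff.1 hx
  exact ⟨a, rfl⟩

/-- `Fin (n+1) ≅ Jset` as a surjective order embedding. [folklore] -/
def eJ [Fintype κ] : Fin (n + 1) ↪o ↥(Jset κ n) :=
  OrderEmbedding.ofMapLEIff (fun j => ⟨toLex (Sum.inr j), mem_Jset_iff.2 ⟨j, rfl⟩⟩) fun a b => by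
    change (toLex (Sum.inr a) : U2 κ n) ≤ toLex (Sum.inr b) ↔ a ≤ b
    exact Sum.Lex.inr_le_inr_iff

/-- `eJ` is onto. [folklore] -/
theorem eJ_surjective [Fintype κ] : Function.Surjective (eJ (κ := κ) (n := n)) := by
  rintro ⟨x, hx⟩
  obtain ⟨j, rfl⟩ := mem_Jset_iff.1 hx
  exact ⟨j, rfl⟩

/-- Membership in the intersections of members of the union cover. [folklore] -/
theorem mem_finset_inf_W {t : Finset (U2 κ n)} {y : Z} :
    y ∈ t.inf (W ι c a₀ π 𝔘) ↔ (∀ a, toLex (Sum.inl a) ∈ t → y ∈ π ⁻¹ᵁ 𝔘.U {a}) ∧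
      ∀ j, toLex (Sum.inr j) ∈ t → y ∈ ZH ι (ell c a₀ j) := by
  rw [PtFamily.mem_finset_inf]
  constructor
  · intro h
    exact ⟨fun a ha => h _ ha, fun j hj => h _ hj⟩
  · rintro ⟨h1, h2⟩ x hx
    obtain ⟨x, rfl⟩ := toLex.surjective x
    rcases x with a | j
    · exact h1 a hx
    · exact h2 j hx

/-- The intersection of members of the first kind over a non-empty set of indices is the preimage
of the corresponding `U_t`. [folklore] -/
theorem finset_inf_map_einl {t : Finset κ} (ht : t.Nonempty) :
    (t.map einl).inf (W ι c a₀ π 𝔘) = π ⁻¹ᵁ 𝔘.U t := by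
  ext y
  change y ∈ (t.map einl).inf (W ι c a₀ π 𝔘) ↔ y ∈ π ⁻¹ᵁ 𝔘.U t
  rw [mem_finset_inf_W]
  constructor
  · rintro ⟨h1, -⟩
    exact (𝔘.mem_iff ht).2 fun a ha => h1 a (Finset.mem_map_of_mem einl ha)
  · intro hy
    refine ⟨fun a ha => ?_, fun j hj => ?_⟩
    · obtain ⟨b, hb, hba⟩ := Finset.mem_map.1 ha
      have : b = a := Sum.inl_injective (toLex.injective hba)
      subst this
      exact (𝔘.mem_iff ht).1 hy b hb
    · obtain ⟨b, _, hba⟩ := Finset.mem_map.1 hj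
      exact absurd (toLex.injective hba) (by simp)

end Union

/-! ### Finite generation of the Čech cohomology of the Chow family -/

section Finite

variable {A : Type u} [CommRing A] [IsNoetherianRing A] {n : ℕ}
  {Z : Scheme.{u}} [IsIntegral Z] (ι : Z ⟶ PP A n) [IsClosedImmersion ι]
  (c : Fin (n + 1) → A) (a₀ : Fin (n + 1)) (hc : c a₀ = 0)
  (ha₀ : genericPoint Z ∈ ZH ι (MvPolynomial.X a₀)) (hℓ : ∀ j, genericPoint Z ∈ ZH ι (ell c a₀ j))
  {V : Scheme.{u}} [IsIntegral V] (q : V ⟶ Spec (.of A)) [IsSeparated q]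
  (π : Z ⟶ V) [IsDominant π] (hι : ι ≫ toSpec A n = π ≫ q)
  [Algebra A V.functionField] [Algebra A Z.functionField]
  (hAV : ∀ a : A, algebraMap A V.functionField a =
    ofSection (U := ⊤) (Set.mem_univ _) (q.appTop ((Scheme.ΓSpecIso (.of A)).inv a)))
  (hAZ : ∀ a : A, algebraMap A Z.functionField a = functionFieldMap π (algebraMap A V.functionField a))
  (hbij : Function.Bijective (functionFieldMap π))
  {κ : Type} [LinearOrder κ] [Fintype κ] (𝔘 : CoverData V κ) (h0 : 𝔘.U ∅ = ⊤)

omit [IsNoetherianRing A] in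
/-- Finite generation along an isomorphism in `ModuleCat`. [folklore] -/
theorem moduleFinite_of_iso {M N : ModuleCat.{u} A} (e : M ≅ N) (h : Module.Finite A M) :
    Module.Finite A N :=
  haveI := h
  Module.Finite.equiv e.toLinearEquiv

include hc hℓ h0 in
/-- **The Čech cohomology of the Chow family `𝓖_d` on `𝔘` is finitely generated over `A`** in every
degree, as soon as `d` is large enough for Serre's vanishing theorem on all the `π⁻¹U_s`
(hypothesis `hvan`, in the Čech form of `Literature/Algebra/Homology/LaurentCechEvalSes` over the
rings `Γ(U_s, 𝒪_V)`): Leray's comparison for the Chow cover through the union of the covers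
`(π⁻¹U_a)` and `(Z_{ℓ_j})` of `Z` (`PtFamily.quasiIso_restrictJ_of_affine`,
`PtFamily.quasiIso_restrictJ_of_base`) and Serre's finiteness theorem for `𝒪_Z(dH)`
(`LaurentCech.moduleFinite_homology_evCplx`). This is Görtz–Wedhorn II, Thm. 23.17, proof,
assertion (3) ("`R^if_*𝓖 ≅ R^i(f ∘ π)_*𝓛^{⊗n}` is coherent") in Čech form over the affine base.
[cite: GortzWedhorn2023, Thm. 23.17 proof (pp. 424–425) with Thm. 23.1 (p. 412) and Thm. 22.9 (p. 332)] -/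
theorem moduleFinite_homology_fam (d : ℤ)
    (hvan : ∀ s₁ : Finset κ, s₁.Nonempty →
      letI := secAlgebraZ π (𝔘.U s₁)
      ∀ m : ℤ, 1 ≤ m → (evCplx Γ(V, 𝔘.U s₁) (theta ι c a₀ ha₀) (isUnit_theta ι c a₀ ha₀ hℓ)
        (fun _ : Unit => (1 : Z.functionField)) (0 : Unit → ℤ) d).ExactAt m)
    (i : ℤ) :
    Module.Finite A ((complex (fam ι c a₀ ha₀ q π hι hAV hAZ hbij 𝔘 d)
      (fam_mono ι c a₀ ha₀ q π hι hAV hAZ hbij 𝔘 d)).homology i) := by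
  classical
  -- notation
  have hregZ := isRegularAt_algebraMap_Z ι q π hι hAV hAZ
  have hAz' := algebraMap_Z_eq ι q π hι hAV hAZ
  set P : Z → Submodule A Z.functionField := Pd ι c a₀ ha₀ hregZ d with hP
  set Wc : U2 κ n → Z.Opens := W ι c a₀ π 𝔘 with hWc
  have hθ := isUnit_theta ι c a₀ ha₀ hℓ
  have hIT : Iset κ n ⊆ Finset.univ := Finset.subset_univ _
  have hJT : Jset κ n ⊆ Finset.univ := Finset.subset_univ _
  -- Step 1: deleting the affine members `Z_{ℓ_j}`
  have hqI : QuasiIso (PtFamily.restrictJ P ⊤ Wc hIT) := by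
    refine PtFamily.quasiIso_restrictJ_of_affine P Wc hIT ?_ ?_ ?_ ?_ ?_
    · obtain ⟨a, -⟩ := 𝔘.exists_mem (genericPoint V)
      exact ⟨toLex (Sum.inl a), mem_Iset_iff.2 ⟨a, rfl⟩⟩
    · intro x
      obtain ⟨a, ha⟩ := 𝔘.exists_mem (π x)
      exact ⟨toLex (Sum.inl a), mem_Iset_iff.2 ⟨a, rfl⟩, ha⟩
    · intro x _
      obtain ⟨x, rfl⟩ := toLex.surjective x
      rcases x with a | j
      · exact genericPoint_mem_preimage π (𝔘.genericPoint_mem {a})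
      · exact hℓ j
    · intro v _ hv t _
      obtain ⟨v, rfl⟩ := toLex.surjective v
      rcases v with a | j
      · exact absurd (mem_Iset_iff.2 ⟨a, rfl⟩) hv
      set t₁ : Finset κ := Finset.univ.filter fun a => toLex (Sum.inl a) ∈ t with ht₁def
      set t₂ : Finset (Fin (n + 1)) :=
        insert j (Finset.univ.filter fun j' => toLex (Sum.inr j') ∈ t) with ht₂def
      have e : Wc (toLex (Sum.inr j)) ⊓ t.inf Wc =
          (t₁.inf fun a => π ⁻¹ᵁ 𝔘.U {a}) ⊓ ZH ι (α c a₀ (Xs A t₂)) := by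
        ext y
        change y ∈ (ZH ι (ell c a₀ j) ⊓ t.inf Wc : Z.Opens) ↔
          y ∈ ((t₁.inf fun a => π ⁻¹ᵁ 𝔘.U {a}) ⊓ ZH ι (α c a₀ (Xs A t₂)) : Z.Opens)
        rw [Opens.mem_inf, Opens.mem_inf, hWc, mem_finset_inf_W, ← finset_inf_ZH_ell ι c a₀ t₂,
          PtFamily.mem_finset_inf, PtFamily.mem_finset_inf, ht₂def, Finset.forall_mem_insert]
        simp only [ht₁def, Finset.mem_filter, Finset.mem_univ, true_and]
        tauto
      rw [e]
      have hZt : IsAffineOpen (ZH ι (α c a₀ (Xs A t₂))) :=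
        isAffineOpen_ZH ι (α_mem c a₀ (Xs_mem t₂)) (Finset.card_pos.2 ⟨j, Finset.mem_insert_self _ _⟩)
      by_cases hne : t₁.Nonempty
      · have e1 : (t₁.inf fun a => π ⁻¹ᵁ 𝔘.U {a}) = π ⁻¹ᵁ 𝔘.U t₁ := by
          ext y
          change y ∈ t₁.inf (fun a => π ⁻¹ᵁ 𝔘.U {a}) ↔ y ∈ π ⁻¹ᵁ 𝔘.U t₁
          rw [PtFamily.mem_finset_inf]
          exact (𝔘.mem_iff hne).symm
        rw [e1, inf_comm]
        exact SeparatedAffinePreimage.isAffineOpen_inf_preimage π q hZt (𝔘.affine hne)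
      · have e1 : (t₁.inf fun a => π ⁻¹ᵁ 𝔘.U {a}) = ⊤ := by
          rw [Finset.not_nonempty_iff_eq_empty.1 hne, Finset.inf_empty]
        rw [e1, top_inf_eq]
        exact hZt
    · intro v _ hv
      obtain ⟨v, rfl⟩ := toLex.surjective v
      rcases v with a | j
      · exact absurd (mem_Iset_iff.2 ⟨a, rfl⟩) hv
      · exact exists_principal_Pd ι c a₀ ha₀ hℓ hregZ d j
  -- Step 2: deleting the members `π⁻¹U_a` (Serre's vanishing on the `π⁻¹U_s`)
  have hqJ : QuasiIso (PtFamily.restrictJ P ⊤ Wc hJT) := by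
    refine PtFamily.quasiIso_restrictJ_of_base P ⊤ Wc hJT ⟨toLex (Sum.inr 0), mem_Jset_iff.2 ⟨0, rfl⟩⟩
      (fun x => ?_) ?_
    · obtain ⟨j, hj⟩ := exists_mem_ZH_ell ι c a₀ hc x
      exact ⟨toLex (Sum.inr j), mem_Jset_iff.2 ⟨j, rfl⟩, hj⟩
    intro s _ hs hsJ m hm
    set s₁ : Finset κ := Finset.univ.filter fun a => toLex (Sum.inl a) ∈ s with hs₁def
    have hs_eq : s = s₁.map einl := by
      ext x
      obtain ⟨x, rfl⟩ := toLex.surjective x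
      rcases x with a | j
      · simp only [hs₁def, Finset.mem_map, Finset.mem_filter, Finset.mem_univ, true_and]
        constructor
        · intro hx; exact ⟨a, hx, rfl⟩
        · rintro ⟨b, hb, hba⟩
          have : b = a := Sum.inl_injective (toLex.injective hba)
          subst this; exact hb
      · constructor
        · intro hx
          exact absurd (mem_Jset_iff.2 ⟨j, rfl⟩) (Finset.disjoint_left.1 hsJ hx)
        · intro hx
          obtain ⟨b, _, hba⟩ := Finset.mem_map.1 hx
          exact absurd (toLex.injective hba) (by simp)
    have hs₁ : s₁.Nonempty := by
      obtain ⟨x, hx⟩ := hs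
      rw [hs_eq] at hx
      obtain ⟨b, hb, -⟩ := Finset.mem_map.1 hx
      exact ⟨b, hb⟩
    have hΩ : (⊤ : Z.Opens) ⊓ s.inf Wc = π ⁻¹ᵁ 𝔘.U s₁ := by
      rw [top_inf_eq, hs_eq, hWc, finset_inf_map_einl ι c a₀ π 𝔘 hs₁]
    rw [hΩ]
    -- reindex the sub-cover `J` along `Fin (n+1) ≅ J`
    set G : Finset (Fin (n + 1)) → Submodule A Z.functionField :=
      PtFamily.cechFam P (π ⁻¹ᵁ 𝔘.U s₁) fun j => ZH ι (ell c a₀ j) with hGdef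
    have heq : ∀ t' : Finset (Fin (n + 1)),
        PtFamily.cechFam P (π ⁻¹ᵁ 𝔘.U s₁) (fun j : ↥(Jset κ n) => Wc ↑j)
          (t'.map (eJ (κ := κ) (n := n)).toEmbedding) = G t' := fun t' => by
      refine PtFamily.cechFam_eq_cechFam fun x => and_congr_right fun _ => ?_
      rw [Finset.forall_mem_map]
      rfl
    haveI := isIso_restrictMapLE (eJ (κ := κ) (n := n)) (fun t' => (heq t').le)
      (PtFamily.cechFam_mono P _ _) (PtFamily.cechFam_mono P _ _) eJ_surjective heq
    have hGex : (complex G (PtFamily.cechFam_mono P _ _)).ExactAt m := by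
      letI := secAlgebraZ π (𝔘.U s₁)
      have hU := 𝔘.genericPoint_mem s₁
      have hUaff := 𝔘.affine hs₁
      refine (OrderedCech.exactAt_iff_of_coe_eq (F := G)
        (G := evFam Γ(V, 𝔘.U s₁) (theta ι c a₀ ha₀) hθ (fun _ : Unit => (1 : Z.functionField))
          (0 : Unit → ℤ) d) (fun t' ht' => ?_) (PtFamily.cechFam_mono P _ _)
        (evFam_mono _ _ hθ _ _ d) m).2 (hvan s₁ hs₁ m hm)
      change ((PtFamily.secs P (π ⁻¹ᵁ 𝔘.U s₁ ⊓ t'.inf fun j => ZH ι (ell c a₀ j)) :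
        Submodule A Z.functionField) : Set Z.functionField) = _
      rw [finset_inf_ZH_ell ι c a₀ t']
      exact secs_Pd_preimage_inf_eq ι c a₀ hc ha₀ hℓ hregZ hAz' q π hι hUaff hU ht' d
    exact hGex.of_iso (asIso (restrictMapLE (eJ (κ := κ) (n := n)) (fun t' => (heq t').le)
      (PtFamily.cechFam_mono P _ _) (PtFamily.cechFam_mono P _ _))).symm
  -- Step 3: the cohomology of the union cover is Serre's, finitely generated
  have hfinU : Module.Finite A ((PtFamily.cplx P ⊤ Wc Finset.univ).homology i) := by
    haveI := hqJ
    refine moduleFinite_of_iso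
      (asIso (HomologicalComplex.homologyMap (PtFamily.restrictJ P ⊤ Wc hJT) i)).symm ?_
    set G0 : Finset (Fin (n + 1)) → Submodule A Z.functionField :=
      PtFamily.cechFam P ⊤ fun j => ZH ι (ell c a₀ j) with hG0def
    have heq0 : ∀ t' : Finset (Fin (n + 1)),
        PtFamily.cechFam P ⊤ (fun j : ↥(Jset κ n) => Wc ↑j)
          (t'.map (eJ (κ := κ) (n := n)).toEmbedding) = G0 t' := fun t' => by
      refine PtFamily.cechFam_eq_cechFam fun x => and_congr_right fun _ => ?_
      rw [Finset.forall_mem_map]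
      rfl
    haveI := isIso_restrictMapLE (eJ (κ := κ) (n := n)) (fun t' => (heq0 t').le)
      (PtFamily.cechFam_mono P _ _) (PtFamily.cechFam_mono P _ _) eJ_surjective heq0
    refine moduleFinite_of_iso ((HomologicalComplex.homologyFunctor _ _ i).mapIso
      (asIso (restrictMapLE (eJ (κ := κ) (n := n)) (fun t' => (heq0 t').le)
        (PtFamily.cechFam_mono P _ _) (PtFamily.cechFam_mono P _ _)))).symm ?_
    have hEq : ∀ t' : Finset (Fin (n + 1)), t'.Nonempty →
        G0 t' = evFam A (theta ι c a₀ ha₀) hθ (fun _ : Unit => (1 : Z.functionField))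
          (0 : Unit → ℤ) d t' := fun t' ht' => by
      change PtFamily.secs P (⊤ ⊓ t'.inf fun j => ZH ι (ell c a₀ j)) = _
      rw [top_inf_eq, finset_inf_ZH_ell ι c a₀ t', hP, secs_Pd_eq_evFam ι c a₀ ha₀ hℓ hregZ hc hAz' ht' d]
    refine moduleFinite_of_iso ((HomologicalComplex.homologyFunctor _ _ i).mapIso
      (FracFamily.complexIsoOfEqOn (PtFamily.cechFam_mono P _ _) (evFam_mono _ _ hθ _ _ d) hEq)).symm ?_
    exact moduleFinite_homology_evCplx A (theta ι c a₀ ha₀) hθ _ _ d i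
  -- Step 4: the sub-cover `I` computes the Čech complex of the Chow family
  have hfinI : Module.Finite A ((PtFamily.cplx P ⊤ Wc (Iset κ n)).homology i) := by
    haveI := hqI
    exact moduleFinite_of_iso (asIso (HomologicalComplex.homologyMap (PtFamily.restrictJ P ⊤ Wc hIT) i)) hfinU
  set GI : Finset κ → Submodule A Z.functionField := PtFamily.cechFam P ⊤ fun a => π ⁻¹ᵁ 𝔘.U {a}
    with hGIdef
  have heqI : ∀ t₁ : Finset κ,
      PtFamily.cechFam P ⊤ (fun x : ↥(Iset κ n) => Wc ↑x) (t₁.map (eI (κ := κ) (n := n)).toEmbedding) =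
        GI t₁ := fun t₁ => by
    refine PtFamily.cechFam_eq_cechFam fun x => and_congr_right fun _ => ?_
    rw [Finset.forall_mem_map]
    rfl
  haveI := isIso_restrictMapLE (eI (κ := κ) (n := n)) (fun t₁ => (heqI t₁).le)
    (PtFamily.cechFam_mono P _ _) (PtFamily.cechFam_mono P _ _) eI_surjective heqI
  have hfinGI : Module.Finite A ((complex GI (PtFamily.cechFam_mono P _ _)).homology i) :=
    moduleFinite_of_iso ((HomologicalComplex.homologyFunctor _ _ i).mapIso
      (asIso (restrictMapLE (eI (κ := κ) (n := n)) (fun t₁ => (heqI t₁).le)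
        (PtFamily.cechFam_mono P _ _) (PtFamily.cechFam_mono P _ _)))) hfinI
  refine OrderedCech.moduleFinite_homology_of_linearEquiv (eK π hAZ hbij)
    (fam_mono ι c a₀ ha₀ q π hι hAV hAZ hbij 𝔘 d) (PtFamily.cechFam_mono P _ _) (fun t₁ x => ?_) i hfinGI
  rw [mem_fam_iff, PtFamily.mem_cechFam]
  by_cases ht₁ : t₁.Nonempty
  · constructor
    · intro h y _ hy
      exact h y ((𝔘.mem_iff ht₁).2 hy)
    · intro h y hy
      exact h y trivial ((𝔘.mem_iff ht₁).1 hy)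
  · rw [Finset.not_nonempty_iff_eq_empty.1 ht₁, h0, Scheme.Hom.preimage_top]
    constructor
    · intro h y _ _
      exact h y trivial
    · intro h y _
      exact h y trivial fun a ha => absurd ha (Finset.notMem_empty a)

end Finite

end ChowFamily

end Literature.AlgebraicGeometry.Motives

end
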